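import Mathlib
import HarnessLib
import Summits.Ventures.LatticeQCDFlow.Scoring.ChainConfidenceInterval

/-!
# How long to run: `N ≥ 8C'/(εs)` and `N ≥ 32 C'² log(2/η)/(ε² s²)` updates certify
# `P(|A_N − πf| > s) ≤ η` from ANY start; `k` observables at once cost `log(2k/η)`

HONEST FRAMING: exact (Metropolis-corrected) sampling algorithms for lattice gauge theory;
figures of merit are autocorrelation/cost numbers at stated couplings and volumes; no
continuum-physics claim.

Venture `LatticeQCDFlow` (cell pub-lqcd), topic `Scoring`; FANOUT row 8 (`s0-cpn-nemc`, GEN-13).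
NEW WORK of the cell, not a published result; no definition is introduced.  Two corollaries of the
certified confidence radius of `Scoring/ChainConfidenceInterval.lean` (`chain_confidence_of_doeblin`,
Hoeffding form, any initial law) in the shape a run plan uses: a sufficient run LENGTH for a target
precision `s` at confidence `1 − η`, and a SIMULTANEOUS statement for finitely many observables by
the union bound.  Nothing is cited as a fact.

## Content (`κ` Markov, `π` invariant, `κ(x, ·) ≥ ε π`, `ε > 0`; `μ₀` ANY probability law;
## `|f| ≤ C`, `C' = C + |πf|`; `A_N = (1/N) Σ_{i<N} f(X_i)`)

* **`chain_sampleSize_of_doeblin`** — if `s > 0`, `0 < η ≤ 1`, `N ≥ 1`, `8C'/(εs) ≤ N` and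
  `32 C'² log(2/η)/(ε² s²) ≤ N`, then `P_{μ₀}(|A_N − πf| > s) ≤ η`;
* **`chain_simultaneous_confidence_of_doeblin`** — for observables `f_j` (`j : Fin k`, `k ≥ 1`,
  `|f_j| ≤ C_j`, `C'_j = C_j + |πf_j|`) and `0 < η ≤ 1`:
  `P_{μ₀}(∃ j, |A_N f_j − πf_j| > 4C'_j/(εN) + √(8 C'_j² log(2k/η)/(ε² N))) ≤ η`.

Reading (value-free): with a Doeblin certificate the run length for a stated precision and
confidence is an explicit function of `ε`, the observable's range and `log(1/η)` — linear in `1/ε`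
for the burn-in offset, quadratic in `C'/(εs)` for the fluctuation — and a table of `k` observables
costs only `log k`.  NOT CLAIMED: any `ε` for a concrete sampler; that these lengths are close to
necessary (they are not: the variance does not enter); unbounded observables.
-/

noncomputable section

namespace Summit.Ventures.LatticeQCDFlow.Scoring

open MeasureTheory ProbabilityTheory Filter Finset Preorder
open scoped ENNReal NNReal

variable {Ω : Type*} [MeasurableSpace Ω]
variable {κ : Kernel Ω Ω} [IsMarkovKernel κ] {μ₀ : Measure Ω} [IsProbabilityMeasure μ₀]
  {π : Measure Ω} [IsProbabilityMeasure π]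

/-- **SUFFICIENT RUN LENGTH, ANY START.**  With `π` invariant, `κ(x, ·) ≥ ε π` (`ε > 0`),
`|f| ≤ C`, `C' = C + |πf|`: if `s > 0`, `0 < η ≤ 1`, `N ≥ 1`, `8C'/(εs) ≤ N` and
`32 C'² log(2/η)/(ε² s²) ≤ N`, then `P_{μ₀}(|(1/N) Σ_{i<N} f(X_i) − πf| > s) ≤ η`. -/
theorem chain_sampleSize_of_doeblin (hπ : Kernel.Invariant κ π) {ε : ℝ≥0∞}
    (hmin : ∀ x {B : Set Ω}, MeasurableSet B → ε * π B ≤ κ x B) (hε0 : 0 < ε)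
    {f : Ω → ℝ} (hf : Measurable f) {C : ℝ} (hC : ∀ x, |f x| ≤ C) {N : ℕ} (hN : N ≠ 0)
    {s η : ℝ} (hs : 0 < s) (hη0 : 0 < η) (hη1 : η ≤ 1)
    (hN1 : 8 * (C + |∫ z, f z ∂π|) / (ε.toReal * s) ≤ N)
    (hN2 : 32 * (C + |∫ z, f z ∂π|) ^ 2 * Real.log (2 / η) / (ε.toReal ^ 2 * s ^ 2) ≤ N) :
    (Kernel.trajMeasure (X := fun _ : ℕ => Ω) μ₀
          (fun m : ℕ => κ.comap (fun y : (i : ↥(Finset.Iic m)) → Ω => y ⟨m, Finset.mem_Iic.2 le_rfl⟩)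
            (measurable_pi_apply _))).real
        {x | s < |(∑ i ∈ Finset.range N, f (x i)) / N - ∫ z, f z ∂π|}
      ≤ η := by
  set Cp := C + |∫ z, f z ∂π| with hCp
  set e := ε.toReal with he
  set L := Real.log (2 / η) with hL
  obtain ⟨-, -, -, -, -, hεr0⟩ := half_const_bounds hmin hε0
  rw [← he] at hεr0
  have hNpos : (0 : ℝ) < N := by exact_mod_cast Nat.pos_of_ne_zero hN
  have hCp0 : 0 ≤ Cp := by
    obtain ⟨x⟩ := nonempty_of_isProbabilityMeasure π
    exact add_nonneg ((abs_nonneg _).trans (hC x)) (abs_nonneg _)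
  have hL0 : 0 ≤ L := Real.log_nonneg (by rw [le_div_iff₀ hη0]; linarith)
  -- the two halves of the radius are each at most `s/2`
  have h1 : 4 * Cp / (e * N) ≤ s / 2 := by
    rw [div_le_iff₀ (by positivity)]
    rw [div_le_iff₀ (by positivity)] at hN1
    nlinarith
  have h2 : Real.sqrt (8 * Cp ^ 2 * L / (e ^ 2 * N)) ≤ s / 2 := by
    have hy : 8 * Cp ^ 2 * L / (e ^ 2 * N) ≤ (s / 2) ^ 2 := by
      rw [div_le_iff₀ (by positivity)]
      rw [div_le_iff₀ (by positivity)] at hN2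
      nlinarith
    calc Real.sqrt (8 * Cp ^ 2 * L / (e ^ 2 * N)) ≤ Real.sqrt ((s / 2) ^ 2) := Real.sqrt_le_sqrt hy
      _ = s / 2 := Real.sqrt_sq (by linarith)
  have hconf := chain_confidence_of_doeblin (μ₀ := μ₀) hπ hmin hε0 hf hC hN hη0 hη1
  rw [← hCp, ← he, ← hL] at hconf
  refine le_trans (measureReal_mono fun x hx => ?_) hconf
  simp only [Set.mem_setOf_eq] at hx ⊢
  linarith

/-- **SIMULTANEOUS CONFIDENCE FOR `k` OBSERVABLES, ANY START.**  With `π` invariant,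
`κ(x, ·) ≥ ε π` (`ε > 0`), observables `f_j` (`j : Fin k`, `k ≥ 1`) with `|f_j| ≤ C_j`,
`C'_j = C_j + |πf_j|`, `N ≥ 1` and `0 < η ≤ 1`:
`P_{μ₀}(∃ j, |(1/N) Σ_{i<N} f_j(X_i) − πf_j| > 4C'_j/(εN) + √(8 C'_j² log(2k/η)/(ε² N))) ≤ η`. -/
theorem chain_simultaneous_confidence_of_doeblin (hπ : Kernel.Invariant κ π) {ε : ℝ≥0∞}
    (hmin : ∀ x {B : Set Ω}, MeasurableSet B → ε * π B ≤ κ x B) (hε0 : 0 < ε)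
    {k : ℕ} (hk : k ≠ 0) {f : Fin k → Ω → ℝ} (hf : ∀ j, Measurable (f j)) {C : Fin k → ℝ}
    (hC : ∀ j x, |f j x| ≤ C j) {N : ℕ} (hN : N ≠ 0) {η : ℝ} (hη0 : 0 < η) (hη1 : η ≤ 1) :
    (Kernel.trajMeasure (X := fun _ : ℕ => Ω) μ₀
          (fun m : ℕ => κ.comap (fun y : (i : ↥(Finset.Iic m)) → Ω => y ⟨m, Finset.mem_Iic.2 le_rfl⟩)
            (measurable_pi_apply _))).real
        {x | ∃ j : Fin k, 4 * (C j + |∫ z, f j z ∂π|) / (ε.toReal * N)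
              + Real.sqrt (8 * (C j + |∫ z, f j z ∂π|) ^ 2 * Real.log (2 * k / η) / (ε.toReal ^ 2 * N))
            < |(∑ i ∈ Finset.range N, f j (x i)) / N - ∫ z, f j z ∂π|}
      ≤ η := by
  set P := Kernel.trajMeasure (X := fun _ : ℕ => Ω) μ₀
      (fun m : ℕ => κ.comap (fun y : (i : ↥(Finset.Iic m)) → Ω => y ⟨m, Finset.mem_Iic.2 le_rfl⟩)
        (measurable_pi_apply _)) with hP
  have hkpos : (0 : ℝ) < k := by exact_mod_cast Nat.pos_of_ne_zero hk
  have hηk0 : 0 < η / k := div_pos hη0 hkpos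
  have hηk1 : η / k ≤ 1 := by
    rw [div_le_one hkpos]
    have : (1 : ℝ) ≤ k := by exact_mod_cast Nat.one_le_iff_ne_zero.2 hk
    linarith
  have hlog : Real.log (2 / (η / k)) = Real.log (2 * k / η) := by
    congr 1; field_simp
  -- each observable at level `η/k`
  have hj : ∀ j : Fin k, P.real {x | 4 * (C j + |∫ z, f j z ∂π|) / (ε.toReal * N)
        + Real.sqrt (8 * (C j + |∫ z, f j z ∂π|) ^ 2 * Real.log (2 * k / η) / (ε.toReal ^ 2 * N))
      < |(∑ i ∈ Finset.range N, f j (x i)) / N - ∫ z, f j z ∂π|} ≤ η / k := fun j => by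
    have h := chain_confidence_of_doeblin (μ₀ := μ₀) hπ hmin hε0 (hf j) (hC j) hN hηk0 hηk1
    rw [← hP, hlog] at h
    exact h
  have hset : {x : ℕ → Ω | ∃ j : Fin k, 4 * (C j + |∫ z, f j z ∂π|) / (ε.toReal * N)
        + Real.sqrt (8 * (C j + |∫ z, f j z ∂π|) ^ 2 * Real.log (2 * k / η) / (ε.toReal ^ 2 * N))
      < |(∑ i ∈ Finset.range N, f j (x i)) / N - ∫ z, f j z ∂π|}
      = ⋃ j : Fin k, {x | 4 * (C j + |∫ z, f j z ∂π|) / (ε.toReal * N)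
        + Real.sqrt (8 * (C j + |∫ z, f j z ∂π|) ^ 2 * Real.log (2 * k / η) / (ε.toReal ^ 2 * N))
      < |(∑ i ∈ Finset.range N, f j (x i)) / N - ∫ z, f j z ∂π|} := by
    ext x; simp
  rw [hset]
  calc P.real (⋃ j : Fin k, _) ≤ ∑ j : Fin k, P.real _ := measureReal_iUnion_fintype_le _
    _ ≤ ∑ _j : Fin k, η / k := Finset.sum_le_sum fun j _ => hj j
    _ = η := by
        rw [Finset.sum_const, Finset.card_univ, Fintype.card_fin, nsmul_eq_mul]
        field_simp

end Summit.Ventures.LatticeQCDFlow.Scoring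

end
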